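import Summits.Langlands.Langlands.Theses.ParityBlindBianchi
import Summits.Langlands.Langlands.Theorems.ParityBlindBianchiTwoAdicBianchiProModularityLevelStubUniformizer
import Summits.Langlands.Langlands.Theorems.ParityBlindBianchiTwoAdicBianchiProModularityLevelStubNormTraceDet
import Summits.Langlands.Langlands.Theorems.ParityBlindBianchiTwoAdicBianchiProModularityLevelStubCharpolyInv
import Summits.Langlands.Langlands.Theorems.ParityBlindBianchiTwoAdicBianchiProModularityLevelStubResidueCardNorm
import HarnessLib

/-!
# `TwoAdicBianchiProModularityLevel` (stmt-Langlands-15110): reduction of the crux to its core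

Item `Summit.Langlands.Langlands.Theses.ParityBlindBianchi.TwoAdicBianchiProModularityLevel` (E2′ of
route ParityBlindBianchi) concludes, for an icosahedral `σ : Γ_K → GL₂(ℚ̄₂)` over a 2-split imaginary
quadratic `K` that is residually automorphic off `S₀ ∋ 2`, the existence of a tame level `U`,
uniformisers `ϖ_v`, `ℤ̄₂`-valued Hecke data `a_{v,i}` at the good places, a continuous point of
`Spf 𝕋(U²)` of the `2`-power Bianchi tower (`IsHeckePoint`) and Hansen association with `σ` at every
good place (`IsHeckeAssociatedAt`).  This file proves, unconditionally, everything in that package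
EXCEPT the Hecke point, and the reduction of the crux to that single statement:

* `exists_heckeData_isHeckeAssociatedAt` — **the Galois half**: for `σ` with finite image,
  unramified with a Frobenius polynomial at every good place, the Hecke eigenvalues of `σ` in
  Hansen's geometric normalisation, `a_{v,1} := tr σ(F) / det σ(F)`, `a_{v,2} := 1 / (q_v det σ(F))`
  (`F` an arithmetic Frobenius; `charpoly σ(F⁻¹) = X² − a_{v,1} X + q_v a_{v,2}`), are `2`-adic
  INTEGERS (`‖tr‖ ≤ 1`, `‖det‖ = 1` for finite-order matrices, `q_v` odd) and are associated with `σ`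
  at every good place;
* `stub_heckeData` — the same in the closed form registered as a stub of the line skeleton;
* `TwoAdicBianchiProModularityLevel_of_core` — **crux ⇐ core**: the crux follows from the single
  statement "any Hecke data Hansen-associated with `σ` at the good places is a continuous point of
  `Spf 𝕋(U²)` for some tame level `U` hyperspecial off `S₀`" (big `R = 𝕋` for `GL₂/K` in defect
  `l₀ = 1` at `p = 2`, read at the Artin point — the open content, stated in the tree's vocabulary as
  the hypothesis `hcore`; it is `stub_core` of the line skeleton `Cruxes/…/Lines/Sketch.lean`).

Sources: D. Hansen, *Universal eigenvarieties…*, J. reine angew. Math. 730 (2017), Def. 1.2.1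
(association, geometric Frobenius); P. Scholze, Ann. of Math. 182 (2015), Thm. V.4.1 (the
normalisation `X² − T_{v,1} X + q_v T_{v,2}`); J.-P. Serre, *Abelian ℓ-adic representations* (1968),
Ch. I §2.1.
-/

noncomputable section

set_option linter.dupNamespace false -- `Summit.Langlands.Langlands` is the mandated namespace (D-0017)

open scoped NumberField MatrixGroups
open Polynomial IsDedekindDomain Field
open Literature.NumberTheory.GaloisRepresentations Literature.NumberTheory.Automorphic

namespace Summit.Langlands.Langlands.Theorems.TwoAdicBianchiProModularityLevel

/-! ### Bookkeeping lemmas used by the composition -/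

/-- An element of a group with finite range-of-a-hom has a positive power equal to one:
if the range of `f` is finite then `f g ^ N = 1` for `N = |range f| > 0`. [folklore] -/
theorem exists_pow_eq_one_of_finite_range {G H : Type*} [Group G] [Group H] (f : G →* H)
    (hf : Finite f.range) (g : G) : ∃ N : ℕ, 0 < N ∧ f g ^ N = 1 := by
  refine ⟨Nat.card f.range, Nat.card_pos, ?_⟩
  have h : (⟨f g, ⟨g, rfl⟩⟩ : f.range) ^ Nat.card f.range = 1 := pow_card_eq_one'
  exact congrArg Subtype.val h

/-- Hansen's polynomial in rank `2` with `t 0 = 1`: `heckeFrobPoly q 2 t = X² − t₁ X + q t₂`.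
[folklore] -/
theorem heckeFrobPoly_two {A : Type*} [CommRing A] (q : ℕ) (t : ℕ → A) (ht : t 0 = 1) :
    heckeFrobPoly q 2 t = X ^ 2 - C (t 1) * X + C ((q : A) * t 2) := by
  simp only [heckeFrobPoly, Finset.sum_range_succ, Finset.sum_range_zero, ht]
  simp
  ring

/-! ### The Galois half: integral Hecke data associated with `σ` -/

/-- **The Galois half of the crux, unconditionally.**  Let `σ : Γ_K → GL₂(ℚ̄₂)` have finite image
and let `S₀ ∋ 2`.  If at every good place `v` (over no prime of `S₀`) `σ` is unramified with a
Frobenius characteristic polynomial, then there are `ℤ̄₂`-valued Hecke data `a_{v,i}` at the good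
places Hansen-associated with `σ` at every good place: `a_{v,1} = tr σ(F)/det σ(F)`,
`a_{v,2} = 1/(q_v det σ(F))` for any arithmetic Frobenius `F` at `v`, so that
`charpoly σ(F⁻¹) = X² − a_{v,1} X + q_v a_{v,2}` (`heckeFrobPoly`).  Integrality: `σ(F)` has finite
order (`stub_normTraceDet`) and `q_v` is odd (`stub_residueCardNorm`).
[cite: HansenUniversalEigenvarieties2017, Def. 1.2.1] -/
theorem exists_heckeData_isHeckeAssociatedAt {K : Type} [Field K] [NumberField K]
    (σ : FramedGaloisRep K (PadicAlgCl 2) 2) (hfin : Finite σ.toMonoidHom.range)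
    (S₀ : Finset ℕ) (h2 : 2 ∈ S₀)
    (hgood : ∀ v : HeightOneSpectrum (𝓞 K), (∀ ℓ ∈ S₀, ((ℓ : ℕ) : 𝓞 K) ∉ v.asIdeal) →
      σ.IsUnramifiedAt v ∧ ∃ P : Polynomial (PadicAlgCl 2), σ.HasFrobCharpolyAt v P) :
    ∃ a : {v : HeightOneSpectrum (𝓞 K) // ∀ ℓ ∈ S₀, ((ℓ : ℕ) : 𝓞 K) ∉ v.asIdeal} → ℕ →
        (PadicAlgCl.valued 2).v.valuationSubring,
      ∀ (v : HeightOneSpectrum (𝓞 K)) (hv : ∀ ℓ ∈ S₀, ((ℓ : ℕ) : 𝓞 K) ∉ v.asIdeal),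
        σ.IsHeckeAssociatedAt v (fun i : ℕ => if i = 0 then (1 : PadicAlgCl 2) else
          ((a ⟨v, hv⟩ i : (PadicAlgCl.valued 2).v.valuationSubring) : PadicAlgCl 2)) := by
  have hP : ∀ v : HeightOneSpectrum (𝓞 K), (∀ ℓ ∈ S₀, ((ℓ : ℕ) : 𝓞 K) ∉ v.asIdeal) →
      ∃ P : Polynomial (PadicAlgCl 2), σ.IsUnramifiedAt v ∧ σ.HasFrobCharpolyAt v P := by
    intro v hv
    obtain ⟨hur, P, hPv⟩ := hgood v hv
    exact ⟨P, hur, hPv⟩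
  choose P hPur hPfrob using hP
  -- `toInt x` is `x` as an element of `𝒪 = {‖x‖ ≤ 1}` when integral, `0` otherwise
  let toInt : PadicAlgCl 2 → (PadicAlgCl.valued 2).v.valuationSubring := fun x =>
    if h : Valued.v x ≤ 1 then ⟨x, (Valuation.mem_valuationSubring_iff _ _).mpr h⟩ else 0
  have coe_toInt : ∀ {x : PadicAlgCl 2}, ‖x‖ ≤ 1 →
      ((toInt x : (PadicAlgCl.valued 2).v.valuationSubring) : PadicAlgCl 2) = x := by
    intro x hx
    have h : Valued.v x ≤ 1 := by
      rw [PadicAlgCl.valuation_def]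
      exact_mod_cast hx
    simp only [toInt, dif_pos h]
  -- the Hecke eigenvalues of σ in Hansen's normalisation
  let a : {v : HeightOneSpectrum (𝓞 K) // ∀ ℓ ∈ S₀, ((ℓ : ℕ) : 𝓞 K) ∉ v.asIdeal} → ℕ →
      (PadicAlgCl.valued 2).v.valuationSubring := fun v i =>
    if i = 1 then toInt (-(P v.1 v.2).coeff 1 * ((P v.1 v.2).coeff 0)⁻¹)
    else if i = 2 then toInt (((v.1.residueCard : ℕ) : PadicAlgCl 2) * (P v.1 v.2).coeff 0)⁻¹
    else 0
  refine ⟨a, fun v hv => ⟨hPur v hv, fun 𝔓 h𝔓 g hg => ?_⟩⟩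
  -- the Frobenius matrix and its invariants
  set M : Matrix (Fin 2) (Fin 2) (PadicAlgCl 2) := ((σ g : GL (Fin 2) (PadicAlgCl 2)) :
    Matrix (Fin 2) (Fin 2) (PadicAlgCl 2)) with hM
  have hcp : M.charpoly = P v hv := hPfrob v hv 𝔓 h𝔓 g hg
  have htr : (P v hv).coeff 1 = -M.trace := by
    rw [← hcp, Matrix.charpoly_fin_two]
    simp
  have hdet : (P v hv).coeff 0 = M.det := by
    rw [← hcp, Matrix.charpoly_fin_two]
    simp
  -- finite order ⇒ integrality
  obtain ⟨N, hN, hgN⟩ := exists_pow_eq_one_of_finite_range σ.toMonoidHom hfin g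
  have hMN : M ^ N = 1 := by
    have := congrArg (fun u : GL (Fin 2) (PadicAlgCl 2) => (u : Matrix (Fin 2) (Fin 2) (PadicAlgCl 2))) hgN
    simpa [hM, Units.val_pow_eq_pow_val] using this
  obtain ⟨htr1, hdet1⟩ := stub_normTraceDet M N hN hMN
  have hq1 : ‖((v.residueCard : ℕ) : PadicAlgCl 2)‖ = 1 :=
    stub_residueCardNorm K v (hv 2 h2)
  have hq0 : ((v.residueCard : ℕ) : PadicAlgCl 2) ≠ 0 := fun h => by simp [h] at hq1
  -- the two eigenvalues are integral, so `a` evaluates to them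
  have ha1 : ((a ⟨v, hv⟩ 1 : (PadicAlgCl.valued 2).v.valuationSubring) : PadicAlgCl 2) =
      M.trace * M.det⁻¹ := by
    have hint : ‖-(P v hv).coeff 1 * ((P v hv).coeff 0)⁻¹‖ ≤ 1 := by
      rw [htr, hdet, neg_neg, norm_mul, norm_inv, hdet1, inv_one, mul_one]
      exact htr1
    simp only [a, if_true]
    rw [coe_toInt hint, htr, hdet, neg_neg]
  have ha2 : ((a ⟨v, hv⟩ 2 : (PadicAlgCl.valued 2).v.valuationSubring) : PadicAlgCl 2) =
      (((v.residueCard : ℕ) : PadicAlgCl 2) * M.det)⁻¹ := by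
    have hint : ‖(((v.residueCard : ℕ) : PadicAlgCl 2) * (P v hv).coeff 0)⁻¹‖ ≤ 1 := by
      rw [hdet, norm_inv, norm_mul, hq1, hdet1, one_mul, inv_one]
    simp only [a, show (2 : ℕ) ≠ 1 by decide, if_false, if_true]
    rw [coe_toInt hint, hdet]
  -- Hansen's normalisation: charpoly σ(F⁻¹) = X² − a₁ X + q a₂
  have hinv : FramedRep.charpoly σ g⁻¹ =
      X ^ 2 - C (M.trace * M.det⁻¹) * X + C M.det⁻¹ := by
    rw [FramedRep.charpoly, map_inv]
    exact stub_charpolyInv (PadicAlgCl 2) (σ g)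
  rw [hinv, heckeFrobPoly_two _ _ (by simp)]
  simp only [show (1 : ℕ) ≠ 0 by decide, show (2 : ℕ) ≠ 0 by decide, if_false, ha1, ha2]
  congr 2
  rw [mul_inv, ← mul_assoc, mul_inv_cancel₀ hq0, one_mul]

/-- REGISTERED STUB `stub_heckeData` of the line skeleton `Cruxes/…/Lines/Sketch.lean` (the Galois
half, closed form of `exists_heckeData_isHeckeAssociatedAt`). [folklore] -/
theorem stub_heckeData : ∀ (K : Type) [Field K] [NumberField K]
    (σ : FramedGaloisRep K (PadicAlgCl 2) 2), Finite σ.toMonoidHom.range →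
    ∀ S₀ : Finset ℕ, 2 ∈ S₀ →
    (∀ v : HeightOneSpectrum (𝓞 K), (∀ ℓ ∈ S₀, ((ℓ : ℕ) : 𝓞 K) ∉ v.asIdeal) →
      σ.IsUnramifiedAt v ∧ ∃ P : Polynomial (PadicAlgCl 2), σ.HasFrobCharpolyAt v P) →
    ∃ a : {v : HeightOneSpectrum (𝓞 K) // ∀ ℓ ∈ S₀, ((ℓ : ℕ) : 𝓞 K) ∉ v.asIdeal} → ℕ →
        (PadicAlgCl.valued 2).v.valuationSubring,
      ∀ (v : HeightOneSpectrum (𝓞 K)) (hv : ∀ ℓ ∈ S₀, ((ℓ : ℕ) : 𝓞 K) ∉ v.asIdeal),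
        σ.IsHeckeAssociatedAt v (fun i : ℕ => if i = 0 then (1 : PadicAlgCl 2) else
          ((a ⟨v, hv⟩ i : (PadicAlgCl.valued 2).v.valuationSubring) : PadicAlgCl 2)) :=
  fun _ _ _ σ hfin S₀ h2 hgood => exists_heckeData_isHeckeAssociatedAt σ hfin S₀ h2 hgood

/-! ### The reduction: crux ⇐ core -/

/-- **Crux ⇐ core.**  `TwoAdicBianchiProModularityLevel` follows from its core `hcore`: for the
crux's data and hypotheses verbatim, ANY family of uniformisers `ϖ` and ANY `ℤ̄₂`-valued Hecke data
`a` Hansen-associated with `σ` at every good place admit a tame level `U` — open, inside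
`GL₂(𝒪̂_K)`, containing every integral `g` trivial at the bad places — at which `a` is a continuous
point of `Spf 𝕋(U²)` of the `2`-power Bianchi tower (`IsHeckePoint`).  `hcore` is big `R = 𝕋` for
`GL₂/K` in defect `l₀ = 1` at `p = 2` read at the Artin point (open; Gee–Newton Conj. 60 /
Calegari–Geraghty / Hansen Conj. 1.2.3); the proof supplies `ϖ` (`stub_uniformizer`) and `a` with
its association (`exists_heckeData_isHeckeAssociatedAt`). [folklore] -/
theorem TwoAdicBianchiProModularityLevel_of_core
    (hcore : ∀ (K : Type) [Field K] [NumberField K], NumberField.IsTotallyComplex K →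
      Module.finrank ℚ K = 2 →
      (∃ v w : HeightOneSpectrum (𝓞 K), v ≠ w ∧ ((2 : ℕ) : 𝓞 K) ∈ v.asIdeal ∧
        ((2 : ℕ) : 𝓞 K) ∈ w.asIdeal) →
      ∀ (ι : PadicAlgCl 2 ≃+* ℂ) (σ : FramedGaloisRep K (PadicAlgCl 2) 2),
      Finite σ.toMonoidHom.range → σ.toGaloisRep.IsIrreducible →
      Nonempty ((Matrix.ProjGenLinGroup.mk.comp σ.toMonoidHom).range ≃* alternatingGroup (Fin 5)) →
      ∀ S₀ : Finset ℕ, 2 ∈ S₀ →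
      (∃ (hcpt : isCompact_glFiniteIntegralLevel 2 K) (π₀ : CuspidalAutomorphicRepData 2 K hcpt),
        π₀.1.IsRegularAlgebraic ∧ ∀ v : HeightOneSpectrum (𝓞 K),
          (∀ ℓ ∈ S₀, ((ℓ : ℕ) : 𝓞 K) ∉ v.asIdeal) →
          ∃ (α : Multiset ℂ) (P : Polynomial (PadicAlgCl 2)), π₀.1.HasSatakeParamAt v α ∧
            σ.IsUnramifiedAt v ∧ σ.HasFrobCharpolyAt v P ∧
            ∀ i : ℕ, ‖P.coeff i - (arithFrobPolyOfSatake ι v.residueCard 2 α).coeff i‖ < 1) →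
      ∀ (ϖ : ∀ v : HeightOneSpectrum (𝓞 K), (v.adicCompletion K)ˣ),
      (∀ v : HeightOneSpectrum (𝓞 K),
        Valued.v ((ϖ v : (v.adicCompletion K)ˣ) : v.adicCompletion K) = WithZero.exp (-1 : ℤ)) →
      ∀ (a : {v : HeightOneSpectrum (𝓞 K) // ∀ ℓ ∈ S₀, ((ℓ : ℕ) : 𝓞 K) ∉ v.asIdeal} → ℕ →
        (PadicAlgCl.valued 2).v.valuationSubring),
      (∀ (v : HeightOneSpectrum (𝓞 K)) (hv : ∀ ℓ ∈ S₀, ((ℓ : ℕ) : 𝓞 K) ∉ v.asIdeal),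
        σ.IsHeckeAssociatedAt v (fun i : ℕ => if i = 0 then (1 : PadicAlgCl 2) else
          ((a ⟨v, hv⟩ i : (PadicAlgCl.valued 2).v.valuationSubring) : PadicAlgCl 2))) →
      ∃ U : Subgroup (GL (Fin 2) (FiniteAdeleRing (𝓞 K) K)),
        IsOpen (U : Set (GL (Fin 2) (FiniteAdeleRing (𝓞 K) K))) ∧
        U ≤ glFiniteIntegralLevel 2 K ∧
        (∀ g ∈ glFiniteIntegralLevel 2 K,
          (∀ v : HeightOneSpectrum (𝓞 K), ¬ (∀ ℓ ∈ S₀, ((ℓ : ℕ) : 𝓞 K) ∉ v.asIdeal) →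
            ∀ i j : Fin 2, ((g : Matrix (Fin 2) (Fin 2) (FiniteAdeleRing (𝓞 K) K)) i j) v =
              (1 : Matrix (Fin 2) (Fin 2) (v.adicCompletion K)) i j) → g ∈ U) ∧
        IsHeckePoint
          (Matrix.GeneralLinearGroup.map (algebraMap K (FiniteAdeleRing (𝓞 K) K)) :
          GL (Fin 2) K →* GL (Fin 2) (FiniteAdeleRing (𝓞 K) K))
          (LevelTower.ofSeq U (fun r : ℕ =>
            (principalCongruenceLevel 2 K (Ideal.span {((2 : ℕ) : 𝓞 K)} ^ r)).map (GLn.sndHom 2 K)))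
          ((2 : ℕ) : (PadicAlgCl.valued 2).v.valuationSubring)
          (fun j : {v : HeightOneSpectrum (𝓞 K) // ∀ ℓ ∈ S₀, ((ℓ : ℕ) : 𝓞 K) ∉ v.asIdeal} × Fin 2 =>
            GLn.sndHom 2 K (heckeDiagAt 2 K j.1.1 (ϖ j.1.1) (j.2.val + 1)))
          (fun j => a j.1 (j.2.val + 1))) :
    Summit.Langlands.Langlands.Theses.ParityBlindBianchi.TwoAdicBianchiProModularityLevel := by
  intro K _ _ htc hdeg hsplit ι σ hfin hirr hA5 S₀ h2 hres
  -- uniformisers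
  choose ϖ hϖ using stub_uniformizer K
  -- the Galois half
  have hgood : ∀ v : HeightOneSpectrum (𝓞 K), (∀ ℓ ∈ S₀, ((ℓ : ℕ) : 𝓞 K) ∉ v.asIdeal) →
      σ.IsUnramifiedAt v ∧ ∃ P : Polynomial (PadicAlgCl 2), σ.HasFrobCharpolyAt v P := by
    obtain ⟨hcpt, π₀, -, hg⟩ := hres
    intro v hv
    obtain ⟨α, P, -, hur, hPv, -⟩ := hg v hv
    exact ⟨hur, P, hPv⟩
  obtain ⟨a, hassoc⟩ := exists_heckeData_isHeckeAssociatedAt σ hfin S₀ h2 hgood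
  -- the core: tame level and Hecke point
  obtain ⟨U, hUo, hUle, hU3, hpt⟩ :=
    hcore K htc hdeg hsplit ι σ hfin hirr hA5 S₀ h2 hres ϖ hϖ a hassoc
  exact ⟨U, ϖ, a, hUo, hUle, hU3, hϖ, hpt, hassoc⟩

end Summit.Langlands.Langlands.Theorems.TwoAdicBianchiProModularityLevel

end
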